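import Summits.CriticalPhenomena.PercolationContinuityZ3.Theorems.Transplant.PlanarSkeletonFrmQuasiDefs
import Summits.CriticalPhenomena.PercolationContinuityZ3.Theorems.Transplant.SkelFrmQuasiBChoiceDefsT
import Summits.CriticalPhenomena.PercolationContinuityZ3.Theorems.Transplant.SkelFrmBChoiceDefsT
import Summits.CriticalPhenomena.PercolationContinuityZ3.Theorems.Transplant.PlanarCells2VDefs
import HarnessLib
import Summits.CriticalPhenomena.PercolationContinuityZ3.Theorems.Transplant.SkelFrmBChoiceCellsV
/-!
# GEN-Q PORT (WAVE-Q table v0.8 section 2, row G054, U-level L10; captain R-6/R-7 2026-08-27: carrier token swap `PlanarSkeletonFrmFrom ↦ PlanarSkeletonFrmQuasi`)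
# of the tree module «Transplant/SkelFrmFromBChoiceCellsV» (sha256 6eccdef73a31447b…) onto the quasi-step carrier `PlanarSkeletonFrmQuasi` (p507026): «SkelFrmQuasiBChoiceCellsV»

ORIGINAL TITLE: N2 (frames-only node `SamePDropOfSkeletonFrm₁`, OPEN) — (ζ″) under (R-44)/(R-45): THE CELL STRUCTURE OF RECORD OF THE SECOND CELL PORT,

builds on p205010 (kernel theorem, internal audit signed; external expert review pending) — nothing in this file uses p205010; NOTHING is claimed about any open node
((N3-b), the end state).  Lane `prim-bschramm`, seat `prim-bschramm-stmt` (gen 33; GEN-Q column pen; tool = captain gen-1 g4's port_genq.py R-14 --cone + p3-g30's T1 patch).  Helper file (`--supports stmt-CriticalPhenomena-4575 --as helper`).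
PORT RULES (U-wave r1–r4 re-used, GEN-Q hunk classes of p3-g29 #6136): declaration order, names and proof texts are those of «SkelFrmFromBChoiceCellsV», byte-identical except
(i) the carrier token `PlanarSkeletonFrmFrom ↦ PlanarSkeletonFrmQuasi` in binders, `namespace`/`end` lines and qualified names (module names `SkelFrmFrom… ↦ SkelFrmQuasi…`
in imports of already-ported rows); (ii) `Φ.step ↦ Φ.qstep` with the called Steps lemma replaced by its `…Q`/`_q` twin and the cost `Φ.M` threaded (none in this file unless
listed below); (iii) `Φ.cyl_connected ↦ Φ.cyl_reach` readers (none unless listed); (iv) graph-ball radii / window floors ×`Φ.M` (none unless listed).  Carrier-free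
residents stay imported/exported from the original «SkelFrmBChoiceCellsV» exactly as in the FrmFrom port.  Docstrings and citations are the original's.

-/

open scoped Classical

noncomputable section

namespace Summit.CriticalPhenomena.PercolationContinuityZ3.Theorems.Transplant

namespace PlanarSkeletonFrmQuasi

namespace NegB

open Literature.Probability.Percolation Literature.Probability.LatticeModels SimpleGraph KNCells
open Literature.Probability.Percolation.KozmaNitzan.Cells (oth oth_oth)
open SkelConc (Consts)
open Skelφ.StepI (DataNS)
open Neg

section Values

variable (κ : Consts) {V : Type} [DecidableEq V] [Countable V] {G : SimpleGraph V} [G.LocallyFinite] (Φ : PlanarSkeletonFrmQuasi G) (t : V)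
  (p : unitInterval) (D : DataNS V) (g f : ℕ) (c hf : Fin 2 → ℕ)

/-- **The PER-AXIS truncated forward room** `hFV hf I := min (hf I) (2·r (oth I))` (the forward room of a step along `I` is felt on the other coordinate,
so it is capped by twice the OTHER half-side, `PCells2V.hF_le`). [this work] -/
def hFV (I : Fin 2) : ℕ := min (hf I) (2 * (fcellsA κ Φ t p D g f).r (oth I))

/-- `hFV I ≤ 2·r (oth I)` and `hFV I ≤ hf I`. [folklore] -/
theorem hFV_le (I : Fin 2) : hFV κ Φ t p D g f hf I ≤ 2 * (fcellsA κ Φ t p D g f).r (oth I) ∧ hFV κ Φ t p D g f hf I ≤ hf I :=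
  ⟨min_le_right _ _, min_le_left _ _⟩

/-- **Under the value row `hf I ≤ 2·r (oth I)` the truncation is the identity**: `hFV I = hf I`. [folklore] -/
theorem hFV_eq (h : ∀ I, hf I ≤ 2 * (fcellsA κ Φ t p D g f).r (oth I)) (I : Fin 2) : hFV κ Φ t p D g f hf I = hf I := min_eq_left (h I)

/-- **THE CELLS OF RECORD OF THE N2 CHAIN UNDER (R-44)/(R-45)** (`PCells2V`): `fcellsT … c` with the backward transverse room `hB I := 2·r (oth I)` (T's room)
and the forward transverse room the truncated slot value `hFV hf`. [cite: KozmaNitzan2024, §4 p. 25 (the renormalised lattice)] -/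
def fcellsV : PCells2V where
  toPCells2T := fcellsT κ Φ t p D g f c
  hB := fun I => 2 * (fcellsA κ Φ t p D g f).r (oth I)
  hF := hFV κ Φ t p D g f hf
  hB_le := fun _ => le_rfl
  hF_le := fun I => (hFV_le κ Φ t p D g f hf I).1

/-- **The underlying T cells are `fcellsT … c` (by `rfl`)** — every T row (per-axis creep cap, `cenS`, the T box family through `toPCells2T`) carries to
the V function with no re-proof. [folklore] -/
@[simp] theorem fcellsV_toPCells2T : (fcellsV κ Φ t p D g f c hf).toPCells2T = fcellsT κ Φ t p D g f c := rfl

/-- The underlying two-unit cells are `fcellsA` (by `rfl`). [folklore] -/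
theorem fcellsV_toPCells2 : (fcellsV κ Φ t p D g f c hf).toPCells2 = fcellsA κ Φ t p D g f := rfl

/-- `r` of the V cells is `fcellsA`'s (by `rfl`). [folklore] -/
theorem fcellsV_r (i : Fin 2) : (fcellsV κ Φ t p D g f c hf).r i = (fcellsA κ Φ t p D g f).r i := rfl

-- GEN-Q (R-2, captain 2026-08-27): `PlanarSkeletonFrmFrom.NegB.fcellsV_s` is not in the used cone of the node top — not ported.

-- GEN-Q (R-2, captain 2026-08-27): `PlanarSkeletonFrmFrom.NegB.fcellsV_K` is not in the used cone of the node top — not ported.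

/-- The creep of the V cells is the truncated creep `cT` (by `rfl`). [folklore] -/
theorem fcellsV_c (i : Fin 2) : (fcellsV κ Φ t p D g f c hf).c i = ((cT κ Φ t p D g f c i : ℕ) : ℤ) := rfl

/-- The backward room is T's: `hB I = 2·r (oth I)` (by `rfl`). [folklore] -/
theorem fcellsV_hB (I : Fin 2) : (fcellsV κ Φ t p D g f c hf).hB I = 2 * (fcellsA κ Φ t p D g f).r (oth I) := rfl

/-- The forward room is the truncated slot value (by `rfl`). [folklore] -/
theorem fcellsV_hF (I : Fin 2) : (fcellsV κ Φ t p D g f c hf).hF I = hFV κ Φ t p D g f hf I := rfl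

-- GEN-Q (R-2, captain 2026-08-27): `PlanarSkeletonFrmFrom.NegB.fcellsV_hF_le_slot` is not in the used cone of the node top — not ported.

/-- **Under the value row `hf I ≤ 2·r (oth I)` the forward room IS the slot value.** [folklore] -/
theorem fcellsV_hF_eq (h : ∀ I, hf I ≤ 2 * (fcellsA κ Φ t p D g f).r (oth I)) (I : Fin 2) : (fcellsV κ Φ t p D g f c hf).hF I = hf I :=
  hFV_eq κ Φ t p D g f hf h I

-- GEN-Q (R-2, captain 2026-08-27): `PlanarSkeletonFrmFrom.NegB.fcellsV_cenS` is not in the used cone of the node top — not ported.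

-- GEN-Q (R-2, captain 2026-08-27): `PlanarSkeletonFrmFrom.NegB.fcellsT_toV_eq` is not in the used cone of the node top — not ported.

end Values

end NegB

end PlanarSkeletonFrmQuasi

end Summit.CriticalPhenomena.PercolationContinuityZ3.Theorems.Transplant

end
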